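import Summits.AtomisticToContinuum.Crystallization.Theorems.FrustratedLawDichotomyExemptLocal

/-!
# FrustratedLawDichotomy · crux `AperiodicFrustratedLawGap` (stmt-AtomisticToContinuum-27623) — the ONE-ATOM MOVE certificate
# for the exchange exemption (`ε`-Nash failure at finite step is `ExchangeUnstable ε ϱ 1`)
# (decomp-a2c, prover hand 1, generation 14; generic, radius-free, DEF-FREE)

The optimality line of record (critic rows 534/537, hand-2 g14: `…ExemptLocOpt` / `…ExemptSplit` / `…ExemptLocal`) refunds every site at
which the cluster fails local optimality; its `e⋆`-free sub-predicate `ExchangeUnstable ε ϱ K y j` asks for a `K`-atom rearrangement inside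
`B̄(y_j, ϱ)` lowering `U` by more than `ε`.  The census instrument (lens-5 g37/g38, AUDIT-g37 «line-search Nash gain `g_j`») measures the
simplest such rearrangement: MOVE THE ATOM `y_j` ITSELF to a point `p` with `|p − y_j| ≤ ϱ`.  This file records that this single evaluation
IS a certificate of the Lean predicate, in finite-sum currency (no `tsum`, no set difference):

* `exchangeUnstable_one_of_move` — `Sep y`, `y` injective, `dist p (y j) ≤ ϱ`, `dist p (y j) < 7/10` and
  `Σ_{k ≠ j} V_LJ(dist p (y k)) + ε < siteEnergy V_LJ y j` ⟹ `ExchangeUnstable ε ϱ 1 y j` (witness `s = (y j)`, `R = (p)`; the new position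
  cannot hit another atom because those are `≥ 7/10` from `y j`);
* `ExchangeUnstable.mono` — monotone in `ε ↓`, `K ↑` (so the one-atom certificate feeds every `K ≥ 1`);
* `exchangeUnstableLoc_one_of_move` — the MOTIF-LOCAL twin for `…ExemptLocal.ExchangeUnstableLoc ε ϱ Rm 1` (both sums over the atoms `k ≠ j`
  with `dist (y k) (y j) ≤ Rm` only), and `exchangeUnstable_one_of_localMove` — composed with `exchangeUnstable_of_loc`: a local gain
  `> ε + 2·T(D)` within `Rm ≥ ϱ + D` certifies the cluster-level exemption;
* `tsum_range_inter_eq_sum_filter` / `tsum_range_diff_singleton_eq` — the bookkeeping `Σ'_{q ∈ range y ∩ T} f q = Σ_{k : y k ∈ T} f (y k)`.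

All `[folklore]`; 0 sorry.  `--supports stmt-AtomisticToContinuum-27623`.
-/

noncomputable section

namespace Summit.AtomisticToContinuum.Crystallization.Theorems.FrustratedLawDichotomyExemptMove

open Metric
open scoped BigOperators
open Literature.MathematicalPhysics.StatisticalMechanics
open Summit.AtomisticToContinuum.Crystallization.Theorems.FrustratedLawDichotomyGSCClusterExactness (tsum_range_eq_sum)
open Summit.AtomisticToContinuum.Crystallization.Theorems.FrustratedLawDichotomyExemptDoor (SitePred)
open Summit.AtomisticToContinuum.Crystallization.Theorems.FrustratedLawDichotomyExemptRemoval (tailConst)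
open Summit.AtomisticToContinuum.Crystallization.Theorems.FrustratedLawDichotomyExemptLocOpt (ExchangeUnstable)
open Summit.AtomisticToContinuum.Crystallization.Theorems.FrustratedLawDichotomyExemptLocal
  (ExchangeUnstableLoc exchangeUnstable_of_loc)
open Summit.AtomisticToContinuum.Crystallization.Theorems.FrustratedLawDichotomyRangeCut (Sep)

/-! ## §1. Bookkeeping: fields over (parts of) the range of an injective cluster are finite sums -/

/-- `range xf ∩ T` is the image finset of the indices landing in `T`. [folklore] -/
theorem range_inter_eq_coe_image {n : ℕ} (xf : Fin n → EuclideanSpace ℝ (Fin 3)) (T : Set (EuclideanSpace ℝ (Fin 3)))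
    [DecidablePred (· ∈ T)] :
    Set.range xf ∩ T = ↑((Finset.univ.filter fun k => xf k ∈ T).image xf) := by
  ext q
  simp only [Set.mem_inter_iff, Set.mem_range, Finset.coe_image, Finset.coe_filter, Finset.mem_univ, true_and,
    Set.mem_image, Set.mem_setOf_eq]
  constructor
  · rintro ⟨⟨k, rfl⟩, hq⟩
    exact ⟨k, hq, rfl⟩
  · rintro ⟨k, hk, rfl⟩
    exact ⟨⟨k, rfl⟩, hk⟩

/-- **Field over `range xf ∩ T` as a finite sum** (injective `xf`): `Σ'_{q ∈ range xf ∩ T} f q = Σ_{k : xf k ∈ T} f (xf k)`. [folklore] -/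
theorem tsum_range_inter_eq_sum_filter {n : ℕ} {xf : Fin n → EuclideanSpace ℝ (Fin 3)} (hxf : Function.Injective xf)
    (T : Set (EuclideanSpace ℝ (Fin 3))) [DecidablePred (· ∈ T)] (f : EuclideanSpace ℝ (Fin 3) → ℝ) :
    ∑' q : ↥(Set.range xf ∩ T), f q = ∑ k ∈ Finset.univ.filter (fun k => xf k ∈ T), f (xf k) :=
  calc ∑' q : ↥(Set.range xf ∩ T), f q
      = ∑' q : ↥(↑((Finset.univ.filter fun k => xf k ∈ T).image xf) : Set (EuclideanSpace ℝ (Fin 3))), f q :=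
        tsum_congr_set_coe f (range_inter_eq_coe_image xf T)
    _ = ∑ q ∈ (Finset.univ.filter fun k => xf k ∈ T).image xf, f q := Finset.tsum_subtype' _ f
    _ = ∑ k ∈ Finset.univ.filter (fun k => xf k ∈ T), f (xf k) := Finset.sum_image fun _ _ _ _ hab => hxf hab

/-- **Field of the OTHER atoms as a finite sum** (injective `y`): `Σ'_{q ∈ range y ∖ {y j}} f q = Σ_{k ≠ j} f (y k)`. [folklore] -/
theorem tsum_range_diff_singleton_eq {N : ℕ} {y : Fin N → EuclideanSpace ℝ (Fin 3)} (hy : Function.Injective y) (j : Fin N)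
    (f : EuclideanSpace ℝ (Fin 3) → ℝ) :
    ∑' q : ↥(Set.range y \ {y j}), f q = ∑ k ∈ Finset.univ.erase j, f (y k) := by
  classical
  have hset : Set.range y \ {y j} = Set.range y ∩ {y j}ᶜ := by
    ext q
    simp only [Set.mem_sdiff, Set.mem_inter_iff, Set.mem_compl_iff]
  rw [tsum_congr_set_coe f hset, tsum_range_inter_eq_sum_filter hy]
  refine Finset.sum_congr ?_ fun _ _ => rfl
  ext k
  simp only [Finset.mem_filter, Finset.mem_univ, true_and, Set.mem_compl_iff, Set.mem_singleton_iff, Finset.mem_erase,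
    and_true, hy.eq_iff]

/-- **Local field of the other atoms as a finite sum** (injective `y`):
`Σ'_{q ∈ (range y ∩ B̄(c, Rm)) ∖ {y j}} f q = Σ_{k ≠ j, dist (y k) c ≤ Rm} f (y k)`. [folklore] -/
theorem tsum_range_ball_diff_singleton_eq {N : ℕ} {y : Fin N → EuclideanSpace ℝ (Fin 3)} (hy : Function.Injective y) (j : Fin N)
    (c : EuclideanSpace ℝ (Fin 3)) (Rm : ℝ) (f : EuclideanSpace ℝ (Fin 3) → ℝ) :
    ∑' q : ↥((Set.range y ∩ closedBall c Rm) \ {y j}), f q =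
      ∑ k ∈ (Finset.univ.erase j).filter (fun k => dist (y k) c ≤ Rm), f (y k) := by
  classical
  have hset : (Set.range y ∩ closedBall c Rm) \ {y j} = Set.range y ∩ (closedBall c Rm ∩ {y j}ᶜ) := by
    ext q
    simp only [Set.mem_sdiff, Set.mem_inter_iff, Set.mem_compl_iff]
    tauto
  rw [tsum_congr_set_coe f hset, tsum_range_inter_eq_sum_filter hy]
  refine Finset.sum_congr ?_ fun _ _ => rfl
  ext k
  simp only [Finset.mem_filter, Finset.mem_univ, true_and, Set.mem_inter_iff, mem_closedBall, Set.mem_compl_iff,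
    Set.mem_singleton_iff, Finset.mem_erase, hy.eq_iff]
  tauto

/-- The interaction energy of a one-point configuration vanishes. [folklore] -/
theorem interactionEnergy_fin_one (V : ℝ → ℝ) (x : Fin 1 → EuclideanSpace ℝ (Fin 3)) : interactionEnergy V x = 0 := by
  unfold interactionEnergy
  rw [Fin.sum_univ_one]
  refine Finset.sum_eq_zero fun k hk => ?_
  have hk0 : k = 0 := Subsingleton.elim _ _
  subst hk0
  simp at hk

/-! ## §2. The one-atom move certificate -/

/-- ★ **ONE-ATOM MOVE ⟹ EXCHANGE-UNSTABLE (`K = 1`)**: over a `7/10`-separated injective cluster, if moving the atom `y_j` to a point `p` with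
`dist p (y j) ≤ ϱ` and `dist p (y j) < 7/10` lowers its field by more than `ε` — `Σ_{k ≠ j} V_LJ(dist p (y k)) + ε < siteEnergy V_LJ y j` —
then `ExchangeUnstable ε ϱ 1 y j` (witness: `s = (y_j)`, `R = (p)`; `p` avoids `y ∖ {y_j}` because those atoms are `≥ 7/10` from `y_j`).
This is the census's «line-search Nash gain `g_j > ε`» as a certificate of the Lean predicate. [folklore] -/
theorem exchangeUnstable_one_of_move {ε ϱ : ℝ} {N : ℕ} {y : Fin N → EuclideanSpace ℝ (Fin 3)} {j : Fin N}
    (hsep : Sep y) (hy : Function.Injective y) {p : EuclideanSpace ℝ (Fin 3)} (hpϱ : dist p (y j) ≤ ϱ)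
    (hp7 : dist p (y j) < 7 / 10)
    (hgain : (∑ k ∈ Finset.univ.erase j, lennardJones (dist p (y k))) + ε < siteEnergy lennardJones y j) :
    ExchangeUnstable ε ϱ 1 N y j := by
  classical
  refine ⟨1, fun _ => y j, fun _ => p, le_rfl, Function.injective_of_subsingleton _, ?_, ?_,
    Function.injective_of_subsingleton _, fun _ => hpϱ, ?_, ?_⟩
  · rintro _ ⟨_, rfl⟩
    exact ⟨j, rfl⟩
  · intro l
    rw [dist_self]
    exact dist_nonneg.trans hpϱ
  · rw [Set.range_const, Set.range_const, Set.disjoint_singleton_left]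
    rintro ⟨⟨k, hk⟩, hpj⟩
    have hkj : k ≠ j := fun h => hpj (by rw [← hk, h]; rfl)
    have h7 := hsep k j hkj
    rw [hk] at h7
    linarith
  · rw [Set.range_const, interactionEnergy_fin_one, interactionEnergy_fin_one, Fin.sum_univ_one, Fin.sum_univ_one,
      tsum_range_diff_singleton_eq hy j (fun q => lennardJones (dist p q)),
      tsum_range_diff_singleton_eq hy j (fun q => lennardJones (dist (y j) q))]
    rw [siteEnergy] at hgain
    linarith

/-- `ExchangeUnstable` is monotone: a smaller gain threshold and a larger atom budget keep an unstable site unstable. [folklore] -/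
theorem ExchangeUnstable.mono {ε ε' ϱ : ℝ} {K K' : ℕ} (hε : ε' ≤ ε) (hK : K ≤ K') {N : ℕ}
    {y : Fin N → EuclideanSpace ℝ (Fin 3)} {j : Fin N} (h : ExchangeUnstable ε ϱ K N y j) : ExchangeUnstable ε' ϱ K' N y j := by
  obtain ⟨a, s, R, haK, hs, hsY, hsball, hR, hRball, hdisj, hlt⟩ := h
  exact ⟨a, s, R, haK.trans hK, hs, hsY, hsball, hR, hRball, hdisj, by linarith⟩

/-- The one-atom move certificate at any atom budget `K ≥ 1`. [folklore] -/
theorem exchangeUnstable_of_move {ε ϱ : ℝ} {K : ℕ} (hK : 1 ≤ K) {N : ℕ} {y : Fin N → EuclideanSpace ℝ (Fin 3)} {j : Fin N}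
    (hsep : Sep y) (hy : Function.Injective y) {p : EuclideanSpace ℝ (Fin 3)} (hpϱ : dist p (y j) ≤ ϱ)
    (hp7 : dist p (y j) < 7 / 10)
    (hgain : (∑ k ∈ Finset.univ.erase j, lennardJones (dist p (y k))) + ε < siteEnergy lennardJones y j) :
    ExchangeUnstable ε ϱ K N y j :=
  ExchangeUnstable.mono le_rfl hK (exchangeUnstable_one_of_move hsep hy hpϱ hp7 hgain)

/-! ## §3. The motif-local twin and its composition with `exchangeUnstable_of_loc` -/

/-- ★ **ONE-ATOM MOVE, MOTIF-LOCAL**: the same certificate for `ExchangeUnstableLoc ε ϱ Rm 1`, both fields summed over the atoms `k ≠ j` with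
`dist (y k) (y j) ≤ Rm` only — decidable from the `Rm`-motif of the site. [folklore] -/
theorem exchangeUnstableLoc_one_of_move {ε ϱ Rm : ℝ} {N : ℕ} {y : Fin N → EuclideanSpace ℝ (Fin 3)} {j : Fin N}
    (hsep : Sep y) (hy : Function.Injective y) {p : EuclideanSpace ℝ (Fin 3)} (hpϱ : dist p (y j) ≤ ϱ)
    (hp7 : dist p (y j) < 7 / 10)
    (hgain : (∑ k ∈ (Finset.univ.erase j).filter (fun k => dist (y k) (y j) ≤ Rm), lennardJones (dist p (y k))) + ε <
      ∑ k ∈ (Finset.univ.erase j).filter (fun k => dist (y k) (y j) ≤ Rm), lennardJones (dist (y j) (y k))) :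
    ExchangeUnstableLoc ε ϱ Rm 1 N y j := by
  classical
  refine ⟨hsep, 1, fun _ => y j, fun _ => p, le_rfl, Function.injective_of_subsingleton _, ?_, ?_,
    Function.injective_of_subsingleton _, fun _ => hpϱ, ?_, ?_⟩
  · rintro _ ⟨_, rfl⟩
    exact ⟨j, rfl⟩
  · intro l
    rw [dist_self]
    exact dist_nonneg.trans hpϱ
  · rw [Set.range_const, Set.range_const, Set.disjoint_singleton_left]
    rintro ⟨⟨k, hk⟩, hpj⟩
    have hkj : k ≠ j := fun h => hpj (by rw [← hk, h]; rfl)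
    have h7 := hsep k j hkj
    rw [hk] at h7
    linarith
  · rw [Set.range_const, interactionEnergy_fin_one, interactionEnergy_fin_one, Fin.sum_univ_one, Fin.sum_univ_one,
      tsum_range_ball_diff_singleton_eq hy j (y j) Rm (fun q => lennardJones (dist p q)),
      tsum_range_ball_diff_singleton_eq hy j (y j) Rm (fun q => lennardJones (dist (y j) q))]
    linarith

/-- ★ **LOCAL MOVE GAIN ⟹ CLUSTER-LEVEL EXEMPTION**: with `Rm ≥ ϱ + D`, `D ≥ 7/10`, a one-atom move inside `B̄(y_j, ϱ)` (step `< 7/10`) whose gain,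
computed from the atoms within `Rm` of `y_j` only, exceeds `ε + 2·T(D)` certifies `ExchangeUnstable ε ϱ 1 y j` — hence the site is refunded in
every exchange-exempt price of the column (`…ExemptLocOpt.aperiodicFrustratedLawGap_of_schurCut_exchange_fourHalf`,
`…ExemptSplit.aperiodicFrustratedLawGap_of_split_exchange_fourHalf`). [folklore] -/
theorem exchangeUnstable_one_of_localMove {ε ϱ Rm D : ℝ} (hRm : ϱ + D ≤ Rm) (hD : (7 : ℝ) / 10 ≤ D)
    {N : ℕ} {y : Fin N → EuclideanSpace ℝ (Fin 3)} {j : Fin N}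
    (hsep : Sep y) (hy : Function.Injective y) {p : EuclideanSpace ℝ (Fin 3)} (hpϱ : dist p (y j) ≤ ϱ)
    (hp7 : dist p (y j) < 7 / 10)
    (hgain : (∑ k ∈ (Finset.univ.erase j).filter (fun k => dist (y k) (y j) ≤ Rm), lennardJones (dist p (y k))) +
        (ε + 2 * (1 : ℕ) * tailConst D) <
      ∑ k ∈ (Finset.univ.erase j).filter (fun k => dist (y k) (y j) ≤ Rm), lennardJones (dist (y j) (y k))) :
    ExchangeUnstable ε ϱ 1 N y j :=
  exchangeUnstable_of_loc hRm hD (exchangeUnstableLoc_one_of_move hsep hy hpϱ hp7 hgain)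

end Summit.AtomisticToContinuum.Crystallization.Theorems.FrustratedLawDichotomyExemptMove

end
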